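import Summits.BirchSwinnertonDyer.BirchSwinnertonDyer.Theorems.EisensteinPrimesSplitMultLocalHZero
import Summits.BirchSwinnertonDyer.BirchSwinnertonDyer.Theorems.EisensteinPrimesAnomalousLocalMover
import Literature.NumberTheory.GaloisRepresentations.ArtinLFunctionDirichletProofs
import Literature.NumberTheory.GaloisRepresentations.TateLevelOneWildOdd
import Literature.NumberTheory.GaloisRepresentations.DirichletCharacterOfGaloisCharacter
import HarnessLib

/-!
# Crux 4 `BSDpOnCellC` (stmt-BirchSwinnertonDyer-19034), line b1 — the SPLIT conjunct of the wall `stub_imprimitiveCount`: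
# THE ORIENTATION SUPPLY — at a split multiplicative Eisenstein prime, if the quotient character `θquot` of the residual pair is
# unramified at `v̄` then the sub-character `θsub` IS ramified at `v̄` (the residual line is the Tate line, orientation (ω, 𝟙))

Cell `bsd-eis` (run/shared/lean/pub/bsd-eis/), width seat `bsd-line-x2-p2` gen 10 (`--supports -19034`, closes nothing; skeleton of
record b1 v12 sha256 155e218d… UNCHANGED, W-79). Supplies the orientation hypothesis `∃ τ ∈ I_v̄, θsub(τ) ≠ 1` of this seat's split
files (`SplitMultLocalHZero` p672062, `…IndexPlumbing` p672519, `…IndexInputs` p672982, `…LambdaLE` p673406, `…SfTransfer`, `…LambdaLEOffP`)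
from the datum the wall's binders carry: the member `φ = θquot` UNRAMIFIED at `p` (`∀ u ∋ p, φ.IsUnramifiedAt u`, whence `θquot|_{Γ_K}`
kills `I_v̄`).

* §1 `eq_one_of_val_smul_eq` — on a group of order `p`, `u.val • y = y` with `y ≠ 0` forces `u = 1` in `(ℤ/p)ˣ`;
* §2 `exists_mem_inertia_modNCyclotomicCharacter_ne_one_of_split` — at a place `v̄` of the imaginary quadratic `K` over the SPLIT odd prime
  `p`, some `τ ∈ I_v̄ ≤ Γ_K` has `χ̄_p(τ) ≠ 1`: over `ℚ` the inertia group at `p` surjects onto `(ℤ/p)ˣ`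
  (`exists_mem_inertia_modNCyclotomicCharacter_eq`, Serre *Local Fields* IV §4), `I_v̄` maps ONTO the rational inertia group at a split prime
  (x1-p1-w2's `AnomalousLocalTorsion.map_absGaloisRestrict_inertia_eq_of_split`), and `χ̄_p` is compatible with restriction
  (`modNCyclotomicCharacter_absGaloisRestrict`);
* §3 `exists_mem_inertia_unitChar_ne_one_of_split_of_quot_unramified` — `W/ℚ` globally minimal, `p ≠ 2` SPLIT multiplicative, `K` imaginary
  quadratic with `(p) = v v̄` split, `(θsub, θquot)` a residual pair of `E_K[p]` with `θquot` TRIVIAL ON `I_v̄`: then some `τ ∈ I_v̄` has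
  `θsub(τ) ≠ 1`. By g9's dichotomy `localData_of_split` the pair is `(𝟙, ω)` or `(ω, 𝟙)` on `D_v̄`; the `τ` of §2 acts on the `ω`-member's line
  by `χ̄_p(τ) ≠ 1`, which §1 forbids for `θquot` (trivial on `I_v̄`), so the line `Φ` is the `ω`-member and `τ` moves it, whence
  `θsub(τ) ≠ 1`; `…_of_isUnramifiedAt` reads the hypothesis from `θquot.IsUnramifiedAt v̄`.

HONEST FRAMING: helper theorems only (0 defs, 0 named facts, 0 sorry); UNCONDITIONAL; closes no stub; no summit statement / BSD / MC / IMC is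
proved for any curve; 0 cells / labels / tiers move.

References: [GreenbergVatsal2000] §2 pp. 14–15; [KellerYin2024] §1.3 Prop. 1.3.1, §5.1 (arXiv:2402.12781v2); [SerreLocalFields1979] Ch. IV §4
Prop. 17–18, Ch. I §7 Prop. 22 (b); [NeukirchANT1999] Ch. I §9 (9.4)–(9.6); [SerreAbelianLadic1968] Ch. I §1.2.
-/

set_option autoImplicit false
-- the route's Theorems namespace repeats the summit name by design (D-0017 nested layout)
set_option linter.dupNamespace false

noncomputable section

open scoped Classical

namespace Summit.BirchSwinnertonDyer.BirchSwinnertonDyer.Theorems.SplitMultOrientation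

open NumberField IsDedekindDomain Field WeierstrassCurve
  Literature.NumberTheory.EllipticCurves Literature.NumberTheory.EllipticCurves.GreenbergSelmer
  Literature.NumberTheory.EllipticCurves.Rank1Residual Literature.NumberTheory.GaloisRepresentations
  Literature.NumberTheory.EllipticCurves.KellerYin2024 Literature.NumberTheory.IwasawaTheory
  Summit.BirchSwinnertonDyer.Rank1Residual.X2.ResidualDevissageModules
  Summit.BirchSwinnertonDyer.Rank1Residual.X11b
  Summit.BirchSwinnertonDyer.BirchSwinnertonDyer.Theorems
  Summit.BirchSwinnertonDyer.BirchSwinnertonDyer.Theorems.CharResidualSelmerCount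

/-! ## §1. A scalar fixing a non-zero point of a group of order `p` is `1` -/

/-- On an additive group of prime order `p`: if `u.val • y = y` for a unit `u ∈ (ℤ/p)ˣ` and `y ≠ 0`, then `u = 1` (`y` has order `p`, so
`p ∣ u.val − 1`). [folklore] -/
theorem eq_one_of_val_smul_eq {p : ℕ} [hp : Fact p.Prime] {G : Type} [AddCommGroup G] (hG : Nat.card G = p) {y : G} (hy : y ≠ 0)
    {u : (ZMod p)ˣ} (h : ((u : ZMod p)).val • y = y) : u = 1 := by
  have hpr : p.Prime := hp.out
  haveI : Finite G := Nat.finite_of_card_ne_zero (by rw [hG]; exact hpr.ne_zero)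
  -- `y` has order `p`
  have hord : addOrderOf y = p := by
    have hdvd : addOrderOf y ∣ p := hG ▸ addOrderOf_dvd_natCard y
    rcases (Nat.dvd_prime hpr).mp hdvd with h1 | h1
    · exact absurd (AddMonoid.addOrderOf_eq_one_iff.mp h1) hy
    · exact h1
  -- `p ∣ u.val - 1` over `ℤ`
  have hz : (((u : ZMod p).val : ℤ) - 1) • y = 0 := by
    rw [sub_smul, one_smul, natCast_zsmul, h, sub_self]
  have hdvd : (p : ℤ) ∣ ((u : ZMod p).val : ℤ) - 1 := by
    have h' : (addOrderOf y : ℤ) ∣ ((u : ZMod p).val : ℤ) - 1 := (addOrderOf_dvd_iff_zsmul_eq_zero).mpr hz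
    rwa [hord] at h'
  have hval : (((u : ZMod p).val : ℤ) : ZMod p) = ((1 : ℤ) : ZMod p) :=
    (ZMod.intCast_eq_intCast_iff_dvd_sub _ _ _).mpr (by rw [← Int.dvd_neg, neg_sub]; exact hdvd)
  rw [Int.cast_natCast, ZMod.natCast_zmod_val, Int.cast_one] at hval
  exact Units.ext hval

/-! ## §2. An inertia element at a split `v̄ ∣ p` with non-trivial mod-`p` cyclotomic character -/

section Cyclotomic

variable {p : ℕ} [hp : Fact p.Prime] {K : Type} [Field K] [NumberField K]

/-- **Some `τ ∈ I_v̄ ≤ Γ_K` has `χ̄_p(τ) ≠ 1`** for `K` imaginary quadratic with `(p) = v v̄` split (`v ≠ v̄` both over `p`), `p ≠ 2`: the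
rational inertia group at `p` contains an element with `χ̄_p = −1` (`exists_mem_inertia_modNCyclotomicCharacter_eq`: `χ̄_p(I_p) = 𝔽_pˣ`), `I_v̄`
maps onto it at a split prime (`map_absGaloisRestrict_inertia_eq_of_split`), and `χ̄_p ∘ res = χ̄_p`. [cite: SerreLocalFields1979, Ch. IV §4 Prop. 17–18]
[cite: NeukirchANT1999, Ch. I §9 (9.6)] [cite: SerreAbelianLadic1968, Ch. I §1.2] -/
theorem exists_mem_inertia_modNCyclotomicCharacter_ne_one_of_split (hp2 : p ≠ 2) (hK : IsImaginaryQuadratic K)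
    {v vbar : HeightOneSpectrum (𝓞 K)} (hpv : ((p : ℕ) : 𝓞 K) ∈ v.asIdeal) (hpvbar : ((p : ℕ) : 𝓞 K) ∈ vbar.asIdeal)
    (hne : vbar ≠ v) :
    ∃ τ ∈ inertia vbar, modNCyclotomicCharacter K p τ ≠ 1 := by
  have hpr : p.Prime := hp.out
  haveI : NeZero p := ⟨hpr.ne_zero⟩
  haveI : Fact (2 < p) := ⟨lt_of_le_of_ne hpr.two_le (Ne.symm hp2)⟩
  -- the rational inertia group below `v̄` and an element with `χ̄_p = -1`
  obtain ⟨hmap, h𝔔⟩ := AnomalousLocalTorsion.map_absGaloisRestrict_inertia_eq_of_split (p := p) hK hpv hpvbar hne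
  have hu : (p : 𝓞 ℚ) ∈ (vbar.under (𝓞 ℚ)).asIdeal := AnomalousLocalTorsion.natCast_mem_under_rat (K := K) hpvbar
  have hgen : Rat.HeightOneSpectrum.natGenerator (vbar.under (𝓞 ℚ)) = p := natGenerator_eq_of_natCast_mem_asIdeal hpr hu
  have hm : p = p ^ (0 + 1) * 1 := by rw [zero_add, pow_one, mul_one]
  have ha : ZMod.unitsMap (Dvd.intro_left _ hm.symm) (-1 : (ZMod p)ˣ) = 1 := Subsingleton.elim _ _
  obtain ⟨τ', hτ'I, hτ'⟩ := exists_mem_inertia_modNCyclotomicCharacter_eq (m := p) hm hpr.not_dvd_one hgen h𝔔 ha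
  -- lift to `I_v̄`
  have hτ'mem : τ' ∈ (inertia vbar).map (absGaloisRestrict ℚ K).toMonoidHom := by rw [hmap]; exact hτ'I
  obtain ⟨τ, hτ, hres⟩ := Subgroup.mem_map.mp hτ'mem
  refine ⟨τ, hτ, fun h1 ↦ ?_⟩
  have h2 : modNCyclotomicCharacter ℚ p τ' = modNCyclotomicCharacter K p τ := by
    rw [← hres]
    exact modNCyclotomicCharacter_absGaloisRestrict (K := ℚ) K p τ
  rw [hτ', h1] at h2
  exact ZMod.neg_one_ne_one (Units.ext_iff.mp h2)

end Cyclotomic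

/-! ## §3. The orientation at a split multiplicative prime from «`θquot` unramified at `v̄`» -/

section Orientation

variable {p : ℕ} [hp : Fact p.Prime] (W : WeierstrassCurve ℚ) [W.IsElliptic] [W.IsGloballyMinimal]
  (K : Type) [Field K] [NumberField K]

/-- **ORIENTATION SUPPLY at a SPLIT multiplicative Eisenstein prime.** `W/ℚ` globally minimal, `p ≠ 2` SPLIT multiplicative, `K` imaginary
quadratic with `(p) = v v̄` split (`ncard = 2`, `v ≠ v̄` both over `p`), `(θsub, θquot)` a residual pair of `E_K[p]` whose quotient character is
TRIVIAL ON `I_v̄` (`∀ τ ∈ I_v̄, unitChar θquot τ = 1` — the member unramified at `p`). Then the sub-character is RAMIFIED at `v̄`: some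
`τ ∈ I_v̄` has `unitChar θsub τ ≠ 1` (the residual line is the Tate line `μ_p`, orientation (ω, 𝟙) — the hypothesis of this seat's split
files). Proof: g9's dichotomy `localData_of_split` («`(θsub, θquot)|_{D_v̄} ∈ {(𝟙, ω), (ω, 𝟙)}`»), the inertia element `τ` of §2 with
`χ̄_p(τ) ≠ 1`, and §1: `τ` cannot fix a non-zero point of the `ω`-member's line, so `(𝟙, ω)` contradicts «`θquot` trivial on `I_v̄`», and in
case `(ω, 𝟙)` `τ` moves `Φ ↪ (F/𝒪)(θsub)`. [cite: GreenbergVatsal2000, §2 pp. 14–15] [cite: KellerYin2024, §1.3 Prop. 1.3.1, §5.1 (arXiv:2402.12781v2)]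
[cite: SerreLocalFields1979, Ch. IV §4 Prop. 17–18] -/
theorem exists_mem_inertia_unitChar_ne_one_of_split_of_quot_unramified (hp2 : p ≠ 2)
    (hsplitred : W.HasSplitMultiplicativeReductionAtPrime p) (hK : IsImaginaryQuadratic K)
    (hsplit : ((Ideal.span {(p : ℤ)}).primesOver (𝓞 K)).ncard = 2)
    {v vbar : HeightOneSpectrum (𝓞 K)} (hpv : ((p : ℕ) : 𝓞 K) ∈ v.asIdeal) (hvbar : ((p : ℕ) : 𝓞 K) ∈ vbar.asIdeal)
    (hne : vbar ≠ v)
    {θsub θquot : FramedGaloisRep K (padicCoeffIntegers (∅ : Set (PadicAlgCl p))) 1}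
    (hpair : IsResidualPairOver (W.baseChange K) p θsub θquot)
    (hquot : ∀ τ ∈ inertia vbar, unitChar θquot τ = 1) :
    ∃ τ ∈ inertia vbar, unitChar θsub τ ≠ 1 := by
  have hpr : p.Prime := hp.out
  haveI hEK : (W.baseChange K).IsElliptic := inferInstanceAs (W.map (algebraMap ℚ K)).IsElliptic
  have hθsub : ∀ σ : absoluteGaloisGroup K, θsub σ ^ (p - 1) = 1 := fun σ ↦ (hpair.pow_sub_one σ).1
  have hθquot : ∀ σ : absoluteGaloisGroup K, θquot σ ^ (p - 1) = 1 := fun σ ↦ (hpair.pow_sub_one σ).2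
  obtain ⟨Φ, hSub, -, ⟨j₁, hj₁, hj₁inj, -⟩, ⟨j₃, hj₃, hj₃inj, -⟩⟩ :=
    ResidualPairStableLine.exists_stableLine_of_isResidualPairOver (W.baseChange K) hpair
  obtain ⟨hQuot, hcases⟩ :=
    ResidualDevissageSplitLocalData.localData_of_split (p := p) W K vbar hsplitred hK hsplit hvbar Φ hSub
  -- an inertia element with non-trivial cyclotomic character
  obtain ⟨τ, hτ, hχ⟩ := exists_mem_inertia_modNCyclotomicCharacter_ne_one_of_split hp2 hK hpv hvbar hne
  have hτD : τ ∈ decomp vbar := GreenbergSelmer.inertia_le_decomp vbar hτ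
  haveI : Finite Φ.Sub := Nat.finite_of_card_ne_zero (by rw [hSub]; exact hpr.ne_zero)
  haveI : Finite Φ.Quot := Nat.finite_of_card_ne_zero (by rw [hQuot]; exact hpr.ne_zero)
  rcases hcases with ⟨-, hcycQ⟩ | ⟨hcyc, -⟩
  · -- (𝟙, ω): `τ` acts on `E_K[p]/Φ` by `χ̄_p(τ) ≠ 1` but `θquot(τ) = 1` fixes it — contradiction
    exfalso
    have hnt : Nontrivial Φ.Quot := by
      rw [← Finite.one_lt_card_iff_nontrivial, hQuot]
      exact hpr.one_lt
    obtain ⟨y₀, hy₀⟩ := exists_ne (0 : Φ.Quot)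
    have hfix : τ • y₀ = y₀ := by
      apply hj₃inj
      rw [hj₃]
      exact CharLocalInertiaFrobenius.smul_eq_self_of_apply_eq_one θquot
        ((GreenbergFullAtSelmer.unitChar_eq_one_iff θquot τ).mp (hquot τ hτ)) (j₃ y₀)
    have h := hcycQ τ hτD y₀
    rw [hfix] at h
    exact hχ (eq_one_of_val_smul_eq hQuot hy₀ h.symm)
  · -- (ω, 𝟙): `τ` moves the line `Φ ↪ (F/𝒪)(θsub)`
    have hnt : Nontrivial Φ.Sub := by
      rw [← Finite.one_lt_card_iff_nontrivial, hSub]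
      exact hpr.one_lt
    obtain ⟨x₀, hx₀⟩ := exists_ne (0 : Φ.Sub)
    refine ⟨τ, hτ, fun h1 ↦ ?_⟩
    have hfix : τ • x₀ = x₀ := by
      apply hj₁inj
      rw [hj₁]
      exact CharLocalInertiaFrobenius.smul_eq_self_of_apply_eq_one θsub
        ((GreenbergFullAtSelmer.unitChar_eq_one_iff θsub τ).mp h1) (j₁ x₀)
    have h := hcyc τ hτD x₀
    rw [hfix] at h
    exact hχ (eq_one_of_val_smul_eq hSub hx₀ h.symm)

/-- **The same from `θquot.IsUnramifiedAt v̄`** (the tree's `FramedGaloisRep.IsUnramifiedAt`: every inertia group above `v̄` maps to `1`;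
`GreenbergSelmer.inertia v̄` is the inertia group of the chosen prime `adicCompletionPrime K v̄`). This is the form in which the wall's binder
«`φ = θquot` unramified at `p`» (over `ℚ`, then restricted to `K`) is delivered. [cite: GreenbergVatsal2000, §2 pp. 14–15]
[cite: SerreAbelianLadic1968, Ch. I §2.1] -/
theorem exists_mem_inertia_unitChar_ne_one_of_split_of_isUnramifiedAt (hp2 : p ≠ 2)
    (hsplitred : W.HasSplitMultiplicativeReductionAtPrime p) (hK : IsImaginaryQuadratic K)
    (hsplit : ((Ideal.span {(p : ℤ)}).primesOver (𝓞 K)).ncard = 2)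
    {v vbar : HeightOneSpectrum (𝓞 K)} (hpv : ((p : ℕ) : 𝓞 K) ∈ v.asIdeal) (hvbar : ((p : ℕ) : 𝓞 K) ∈ vbar.asIdeal)
    (hne : vbar ≠ v)
    {θsub θquot : FramedGaloisRep K (padicCoeffIntegers (∅ : Set (PadicAlgCl p))) 1}
    (hpair : IsResidualPairOver (W.baseChange K) p θsub θquot)
    (hquot : θquot.IsUnramifiedAt vbar) :
    ∃ τ ∈ inertia vbar, unitChar θsub τ ≠ 1 := by
  refine exists_mem_inertia_unitChar_ne_one_of_split_of_quot_unramified W K hp2 hsplitred hK hsplit hpv hvbar hne hpair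
    fun τ hτ ↦ ?_
  have e : inertia vbar = (adicCompletionPrime K vbar).inertia (absoluteGaloisGroup K) :=
    (inertia_adicCompletionPrime_eq_map_absInertia K vbar).symm
  rw [e] at hτ
  exact CharLocalInertiaFrobenius.unitChar_eq_one_of_apply_eq_one θquot
    (hquot _ (adicCompletionPrime_mem_primesAbove K vbar) τ hτ)

end Orientation

end Summit.BirchSwinnertonDyer.BirchSwinnertonDyer.Theorems.SplitMultOrientation

end
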